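/-
Origin: written from primary sources — W. Fulton, J. Harris, *Representation Theory* (1991) §B.1 / Lecture 6 (exterior
powers: `∧² ` of a two-dimensional representation is its determinant character); R. Howe, *θ-series and invariant
theory* (1979) §2 (the see-saw: products of theta series of the small pairs inside the oscillator representation of
the big pair). Adapted: no. Elementary bilinear algebra: the antisymmetrised value `t a₀ b₁ - t a₁ b₀` of a bilinear
map on two PAIRS of vectors transforms, under endomorphisms acting on both pairs through the SAME `2 × 2` matrix, by the
determinant of that matrix; consequently it is a weight vector (for the determinant character) of any operator family
that restricts on the nose to such a pair of actions. Kernel only, Mathlib + the tree's `weightSpace`.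
-/
import Mathlib.RepresentationTheory.Basic
import Mathlib.LinearAlgebra.Matrix.Determinant.Basic
import Literature.RepresentationTheory.CharacterIsotypicSubspace
import HarnessLib

/-!
# The wedge of two pairs through a bilinear map transforms by the determinant

Setting: a commutative ring `R`, modules `S₁, S₂, S`, a bilinear map `t : S₁ →ₗ[R] S₂ →ₗ[R] S` (model case: the
external tensor `⊠` of Schwartz–Bruhat functions, or any transported version `R ∘ ⊠`), and two PAIRS of vectors
`a : Fin 2 → S₁`, `b : Fin 2 → S₂` (model case: bases of two copies of the two-dimensional `K`-type `𝔭₊` inside the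
oscillator representations of the two small pairs of a see-saw).

* `wedgePair t a b := t (a 0) (b 1) - t (a 1) (b 0)` — the antisymmetrised tensor (model case: PerL's
  `φ₁¹ ⊠ φ₂² − φ₁² ⊠ φ₂¹`, whose theta lift is the wedge `u₁ ∧ u₂` of two one-forms read as a scalar function);
* **`wedgePair_of_matrix`** — if `A (a i) = Σ_j m j i • a j` and `B (b i) = Σ_j m j i • b j` for ONE matrix
  `m : Matrix (Fin 2) (Fin 2) R` (both pairs transform through the same matrix — the same `K`-type in matched bases),
  then `wedgePair t (A ∘ a) (B ∘ b) = det m • wedgePair t a b` (`∧²` of a two-dimensional representation is `det`);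
* **`wedgePair_mem_weightSpace`** — for a representation `M` of `G` on `S`, families `A : G → End S₁`,
  `B : G → End S₂` and a family of elements `ι : T → G` such that `M (ι k)` restricts ON THE NOSE to `(A (ι k), B (ι k))`
  on the pairs (`M (ι k) (t (a i) (b j)) = t (A (ι k) (a i)) (B (ι k) (b j))`) and both pairs transform through the
  same matrix `m k`, the wedge `wedgePair t a b` lies in `weightSpace M ι (fun k => det (m k))`
  (`CharacterIsotypicSubspace`) — model case: the see-saw witness of PerL's (12) meeting lies in the `κ`-isotypic
  subspace `𝒮^κ`, `κ = ∧²𝔭₊ ⊠ 𝟏 = det` of the `𝔭₊`-matrix (`UnitaryGroupArchIsotropy.kappaIsotypic`).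

Everything is kernel-proved; `[folklore]` throughout.
-/

namespace Literature.RepresentationTheory

section Wedge

variable {R : Type*} [CommRing R] {S₁ S₂ S : Type*} [AddCommGroup S₁] [Module R S₁] [AddCommGroup S₂]
  [Module R S₂] [AddCommGroup S] [Module R S]

/-- **The wedge of two pairs through a bilinear map**: `t a₀ b₁ - t a₁ b₀`. [folklore] -/
def wedgePair (t : S₁ →ₗ[R] S₂ →ₗ[R] S) (a : Fin 2 → S₁) (b : Fin 2 → S₂) : S :=
  t (a 0) (b 1) - t (a 1) (b 0)

/-- Unfolding. [folklore] -/
theorem wedgePair_def (t : S₁ →ₗ[R] S₂ →ₗ[R] S) (a : Fin 2 → S₁) (b : Fin 2 → S₂) :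
    wedgePair t a b = t (a 0) (b 1) - t (a 1) (b 0) := rfl

/-- The wedge is antisymmetric under the simultaneous swap of both pairs' roles: swapping the indices of BOTH
pairs changes the sign. [folklore] -/
theorem wedgePair_swap (t : S₁ →ₗ[R] S₂ →ₗ[R] S) (a : Fin 2 → S₁) (b : Fin 2 → S₂) :
    wedgePair t (fun i => a (Equiv.swap 0 1 i)) (fun i => b (Equiv.swap 0 1 i)) = -wedgePair t a b := by
  simp only [wedgePair, Equiv.swap_apply_left, Equiv.swap_apply_right, neg_sub]

/-- A linear map after the wedge: `f (wedgePair t a b) = wedgePair (f ∘ t) a b`. [folklore] -/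
theorem map_wedgePair {S' : Type*} [AddCommGroup S'] [Module R S'] (f : S →ₗ[R] S') (t : S₁ →ₗ[R] S₂ →ₗ[R] S)
    (a : Fin 2 → S₁) (b : Fin 2 → S₂) : f (wedgePair t a b) = wedgePair (t.compr₂ f) a b := by
  simp only [wedgePair, map_sub, LinearMap.compr₂_apply]

/-- **`∧²` of a two-dimensional action is the determinant**: if both pairs transform through the same matrix `m`
(`A (a i) = Σ_j m j i • a j`, `B (b i) = Σ_j m j i • b j`), the wedge transforms by `det m`. [folklore] -/
theorem wedgePair_of_matrix (t : S₁ →ₗ[R] S₂ →ₗ[R] S) (a : Fin 2 → S₁) (b : Fin 2 → S₂)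
    (m : Matrix (Fin 2) (Fin 2) R) (A : S₁ →ₗ[R] S₁) (B : S₂ →ₗ[R] S₂)
    (hA : ∀ i, A (a i) = ∑ j, m j i • a j) (hB : ∀ i, B (b i) = ∑ j, m j i • b j) :
    wedgePair t (fun i => A (a i)) (fun i => B (b i)) = m.det • wedgePair t a b := by
  simp only [wedgePair, hA, hB, Fin.sum_univ_two, map_add, map_smul, LinearMap.add_apply, LinearMap.smul_apply,
    Matrix.det_fin_two]
  -- both sides are `R`-combinations of the four values `t (a i) (b j)`
  module

/-- The same with the actions written as values `A i := A (a i)` etc.: a version taking the transformed pairs as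
hypotheses on arbitrary new pairs `a', b'`. [folklore] -/
theorem wedgePair_eq_det_smul (t : S₁ →ₗ[R] S₂ →ₗ[R] S) (a a' : Fin 2 → S₁) (b b' : Fin 2 → S₂)
    (m : Matrix (Fin 2) (Fin 2) R) (ha : ∀ i, a' i = ∑ j, m j i • a j) (hb : ∀ i, b' i = ∑ j, m j i • b j) :
    wedgePair t a' b' = m.det • wedgePair t a b := by
  simp only [wedgePair, ha, hb, Fin.sum_univ_two, map_add, map_smul, LinearMap.add_apply, LinearMap.smul_apply,
    Matrix.det_fin_two]
  module

end Wedge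

/-! ### The wedge as a weight vector for the determinant character -/

section Weight

variable {R : Type*} [CommRing R] {S₁ S₂ S : Type*} [AddCommGroup S₁] [Module R S₁] [AddCommGroup S₂]
  [Module R S₂] [AddCommGroup S] [Module R S] {G : Type*} [Monoid G] {T : Type*}

/-- **The see-saw wedge is `det`-isotypic.**  Let `M : G →* End S` restrict ON THE NOSE, at the elements `ι k`,
to a pair of operator families `(A (ι k), B (ι k))` on the four products `t (a i) (b j)`, and let both pairs `a, b`
transform under `A (ι k)`, `B (ι k)` through the same matrix `m k`.  Then `wedgePair t a b` is a weight vector of the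
family `M ∘ ι` with weight `k ↦ det (m k)` — in the model: the antisymmetrised tensor of two `𝔭₊`-type vectors lies
in the `∧²𝔭₊ ⊠ 𝟏`-isotypic subspace `𝒮^κ` of the big oscillator representation. [folklore] -/
theorem wedgePair_mem_weightSpace (M : Representation R G S) (ι : T → G) (t : S₁ →ₗ[R] S₂ →ₗ[R] S)
    (A : G → S₁ →ₗ[R] S₁) (B : G → S₂ →ₗ[R] S₂) (a : Fin 2 → S₁) (b : Fin 2 → S₂)
    (m : T → Matrix (Fin 2) (Fin 2) R)
    (hres : ∀ (k : T) (i j : Fin 2), M (ι k) (t (a i) (b j)) = t (A (ι k) (a i)) (B (ι k) (b j)))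
    (hA : ∀ (k : T) (i : Fin 2), A (ι k) (a i) = ∑ j, m k j i • a j)
    (hB : ∀ (k : T) (i : Fin 2), B (ι k) (b i) = ∑ j, m k j i • b j) :
    wedgePair t a b ∈ weightSpace M ι (fun k => (m k).det) := by
  rw [mem_weightSpace]
  intro k
  have h := wedgePair_of_matrix t a b (m k) (A (ι k)) (B (ι k)) (hA k) (hB k)
  simp only [wedgePair_def] at h
  rw [wedgePair_def, map_sub, hres, hres, h]

/-- Variant with the restriction hypothesis stated for ALL vectors (`M (ι k) (t x y) = t (A (ι k) x) (B (ι k) y)`),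
the shape of an on-the-nose see-saw restriction identity. [folklore] -/
theorem wedgePair_mem_weightSpace' (M : Representation R G S) (ι : T → G) (t : S₁ →ₗ[R] S₂ →ₗ[R] S)
    (A : G → S₁ →ₗ[R] S₁) (B : G → S₂ →ₗ[R] S₂) (a : Fin 2 → S₁) (b : Fin 2 → S₂)
    (m : T → Matrix (Fin 2) (Fin 2) R)
    (hres : ∀ (k : T) (x : S₁) (y : S₂), M (ι k) (t x y) = t (A (ι k) x) (B (ι k) y))
    (hA : ∀ (k : T) (i : Fin 2), A (ι k) (a i) = ∑ j, m k j i • a j)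
    (hB : ∀ (k : T) (i : Fin 2), B (ι k) (b i) = ∑ j, m k j i • b j) :
    wedgePair t a b ∈ weightSpace M ι (fun k => (m k).det) :=
  wedgePair_mem_weightSpace M ι t A B a b m (fun k i j => hres k (a i) (b j)) hA hB

end Weight

end Literature.RepresentationTheory
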